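import Summits.BirchSwinnertonDyer.BirchSwinnertonDyer.Theses.InertBadSignedBranches
import Summits.BirchSwinnertonDyer.BirchSwinnertonDyer.Theorems.InertBadSignedBranchesInertBadAtThreeIstarZeroOfPublishedFacts
import HarnessLib

/-!
# Route `InertBadSignedBranches` (rung K8), D71 child `InertBadAtThreeIstarZero`: the item with ONE
# displayed binder per `p = 3` input, the two READING binders in the VERBATIM `W`-FREE print shapes of
# the route's readings item `PrintReadingsInert` (helper toward stmt-BirchSwinnertonDyer-19656;
# cell `bsd-cm`, seat `bsd-cm-k8i-c41`; theorems only, nothing asserted)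

HONEST FRAMING (cell `bsd-cm`, run/shared/lean/pub/bsd-cm/): Birch–Swinnerton-Dyer is NOT proved by
any of this. The item `InertBadAtThreeIstarZero` (D71 split child 1 of the RESIDUAL conjunct
`InertBadAtThree` of the rung route K8) is the `3`-part of the BSD formula for every globally minimal CM
curve `W/ℚ` of signed local type `(3, I₀*)` (`3` inert in the CM field, additive of Kodaira type `I₀*` at
`3`) and analytic rank one — OPEN in print (the only located text, J. Pan's 2017 thesis, is unpublished
and unread; Tian, Proc. ICM 2022, p. 1993, attribution only). Nothing in this file closes it: every
theorem below is CONDITIONAL on displayed hypotheses, and the class served (O10-PS@3, 57 classes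
`N < 5·10⁵` of the cell census) stays CONSTRUCTION-SHAPED and OPEN. THEOREMS ONLY: 0 definitions,
0 named facts minted, 0 `sorry`; no label or mark moves.

PARTITION (D-0054): CornerF inert-bad (B12 / O10) × O10-PS@3 = the 57 rank-one classes of signed local
type `(3, I₀*)` × `p = 3` — types-the-object-of: restates the child as
"kernel modulo (GZ_η-VAL)@3 [or C-cc-1@3 in pair form] ∧ (C1_η)@3 ∧ `hKO`@3 ∧ `h74X`@3 ∧
`PublishedFactsInert`", where `hKO`@3 / `h74X`@3 are — up to `p := 3` — the SAME binder texts to which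
the seat bsd-cm-inert reduced the route's readings item `PrintReadingsInert` (p410220,
`inertBadSignedBranches_printReadingsInert_of_plusMC_of_verbatimReadings`: Kitajima–Otsuki 2018 Main
Thm. 1.3, sign `−`, and Kobayashi 2003 Thm. 7.4 (ii) EXACT, both on the `η`-part object
`Additive.EtaSignedSelmerDualData V κ K₀ ℚ_[p] η γ (−1)` of ANY good `a_p = 0` curve `V`, `W`-free);
closes no cell, books nothing.

## Why the `p = 3` readings are the `p ≥ 5` readings read at `3` (no new print debt)

* (C1_η)@3 — Pollack–Rubin's standing hypothesis is "`p > 2` is a prime where `E` has good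
  supersingular reduction" [PollackRubin2004 p. 447]; the `ℚ(μ_{p^∞})` variant is their REMARK (p. 448)
  at every such `p`, so the binder `hC1₃` below has exactly the print tier of the `p ≥ 5` clause of
  `PrintReadingsInert` (conjecture-grade typed input `Additive.QuadraticBranchPlusMainConjectureAt V 3`).
* `hKO`@3 / `h74X`@3 — Kobayashi 2003 and Kitajima–Otsuki 2018 assume `p` odd and `a_p = 0` (at `p = 3`
  the latter is a hypothesis, automatic here: CM with `3` inert ⇒ `a₃(V) = 0`, displayed as
  `V.frobeniusTrace 3 = 0`); the x1b dictionary theorems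
  `SignedTwist.oddBranchStrictMinusNoFiniteSubmoduleAt_of_kitajimaOtsuki13MinusEta` and
  `LevelBridge.exactOddBranchReading_of_kobayashi74OddEtaExact` carry NO `5 ≤ p` and transport the two
  texts to every `W` of the type at `p = 3` verbatim (`p* = −3`, the minus / imaginary period).
* the law — displayed in BOTH kernel normal forms of record (referee NIT-ETAGZ-1): print/LOG currency
  (GZ_η-VAL)@3 (`coeff₁ L ≠ 0 ∧ v₃(coeff₁ L) = 2·ord₃ log_ω(P) + ord₃(L′(W,1)/(Ω_W·Reg W))`) and
  pair/LEVEL currency C-cc-1@3 (`… = 2n + ord₃(#Ш_an·∏c_v/#tors²)` at `3`-divisibility level `n` of the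
  generator, under `W(ℚ₃)[3] = 0`). This is the ONE input at `3` with no print behind it.
So a by-name Literature typing of the two reading texts for ODD `p` (the typer seat's task on item
19226) discharges `hKO₃` / `h74X₃` here by instantiation at `p = 3`, and the child then reads
"kernel modulo the law at `3` ∧ (C1_η)@3 ∧ published named facts" — the exact standing of the `p ≥ 5`
branch of the route modulo its crux `CccOneLawOnTypeIstarZero`.

## What is here

* `inertBadSignedBranches_readingsAtThree_of_verbatimReadingsAtThree` — the `W`-dependent readings
  binder of the x1b / inert `p = 3` nodes ((R2)@3 ∧ Kobayashi 7.4 (ii) exact at `3` on the type) FROM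
  `hKO₃` ∧ `h74X₃`;
* `inertBadSignedBranches_readingsAtThree_of_oddVerbatimReadings` — the same FROM the `p`-generic
  texts (the 19226 binders with the guard `5 ≤ p` deleted), instantiated at `p = 3`;
* `inertBadSignedBranches_inertBadAtThreeIstarZero_of_etaGZValuationAtThree_of_verbatimReadingsAtThree`
  — THE ITEM (fully-qualified route type) ⟸ (GZ_η-VAL)@3 ∧ (C1_η)@3 ∧ `hKO₃` ∧ `h74X₃` ∧
  `PublishedFactsInert`;
* `inertBadSignedBranches_inertBadAtThreeIstarZero_of_pairLawAtThree_of_verbatimReadingsAtThree` — the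
  same with the law in pair/LEVEL form.

References (locators only): [Kobayashi2003] §4 (p. 8), Thm. 7.4 (p. 13); [KitajimaOtsuki2018] Main
Thm. 1.3 (= Thm. 4.8) with Def. 2.1 (arXiv:1607.03612 pp. 3, 6); [PollackRubin2004] Theorem (p. 448)
and the remark on Sel over ℚ(μ_{p^∞}) (p. 448); [Mazur1978] Cor. 4.1; [SilvermanATAEC1994] IV.9.4,
Table 4.1; [Miller2011LMS] §1, Def. 1.1; [Tian2023CongruentICM] p. 1993 (attribution only).
-/

set_option autoImplicit false
set_option linter.dupNamespace false

noncomputable section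

open scoped Classical MatrixGroups ModularForm NumberField

open CongruenceSubgroup Field NumberField IsDedekindDomain IsDedekindDomain.HeightOneSpectrum
  WeierstrassCurve Rat.HeightOneSpectrum
open Literature.NumberTheory.EllipticCurves
open Literature.NumberTheory.EllipticCurves.ModularForms
open Literature.NumberTheory.EllipticCurves.Kobayashi2003 hiding EtaSignedSelmerDualData
  IsQuadraticBranchMinusLFunction
open Literature.NumberTheory.EllipticCurves.Rank1Residual
open Literature.NumberTheory.EllipticCurves.Rank1Residual.Typed
open Literature.NumberTheory.GaloisRepresentations
open Literature.NumberTheory.GaloisCohomology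
open Summit.BirchSwinnertonDyer.Rank1Residual
open Summit.BirchSwinnertonDyer.Rank1Residual.Additive
open Summit.BirchSwinnertonDyer.Rank1Residual.Additive.LocalLog
open Summit.BirchSwinnertonDyer.Rank1Residual.X12.O10
open Summit.BirchSwinnertonDyer.BirchSwinnertonDyer.Theses.InertBadSignedBranches
open Summit.BirchSwinnertonDyer.BirchSwinnertonDyer.Theorems.InertBadOdd

namespace Summit.BirchSwinnertonDyer.BirchSwinnertonDyer.Theorems

/-- **The readings at `3` on the type `(3, I₀*)` FROM their VERBATIM `W`-FREE SHAPES.** Hypotheses: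
`hKO₃` = Kitajima–Otsuki 2018 Main Thm. 1.3 (sign `−`) on the `η`-part dual datum
`EtaSignedSelmerDualData V κ K₀ ℚ_[3] η γ (−1)` of ANY globally minimal `V/ℚ` good at `3` with
`a₃(V) = 0`, over any `K₀ = ℚ(μ₃)` (the text `hKO` of `…PrintReadingsInert` at `p = 3`); `h74X₃` =
Kobayashi 2003 Thm. 7.4 (ii) EXACT at `η` on the same object, given (C1_η)@3 at `V` (the text `h74X`
at `p = 3`, period clause read at `p* = −3`: imaginary period / `minusPeriod`). Conclusion: for every
`W` of signed local type `(3, I₀*)` with `r_an(W) = 1`, (R2)@3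
`OddBranchStrictMinusNoFiniteSubmoduleAt W 3` and the exact strict-minus reading at `3` — the binder
`hRd` of the inert / x1b `p = 3` nodes — by the x1b dictionary theorems (no `5 ≤ p` inside).
CONDITIONAL; nothing about the printed theorems is asserted; closes nothing by itself.
[cite: KitajimaOtsuki2018, Main Thm. 1.3 (= Thm. 4.8) with Def. 2.1 (arXiv:1607.03612 pp. 3, 6)]
[cite: Kobayashi2003, Thm. 7.4 (p. 13), §4 (p. 8), Thm. 2.2 (p. 5)] -/
theorem inertBadSignedBranches_readingsAtThree_of_verbatimReadingsAtThree
    (hKO₃ : ∀ (K₀ : Type) [Field K₀] [NumberField K₀] [IsCyclotomicExtension {3} ℚ K₀]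
        [(galRange (K := ℚ) K₀).Normal] (ηq : absoluteGaloisGroup ℚ →* ℤˣ),
        (∀ σ ∈ galRange (K := ℚ) K₀, ηq σ = 1) →
      ∀ (V : WeierstrassCurve ℚ) [V.IsElliptic] [V.IsGloballyMinimal],
        (3 : ℕ) ≠ 2 → V.HasGoodReductionAtPrime 3 → V.frobeniusTrace 3 = 0 →
      ∀ (κ : ZpExtension ℚ 3) (γ : absoluteGaloisGroup ℚ),
        κ.IsCyclotomic → κ.IsTopGenerator γ → γ ∈ galRange (K := ℚ) K₀ →
      ∀ (D : EtaSignedSelmerDualData V κ K₀ ℚ_[3] ηq γ (-1)),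
        Module.Finite (IwasawaAlgebra 3) D.X → Module.IsTorsion (IwasawaAlgebra 3) D.X →
        ∀ M : Submodule (IwasawaAlgebra 3) D.X, Finite M → M = ⊥)
    (h74X₃ : ∀ (K₀ : Type) [Field K₀] [NumberField K₀] [IsCyclotomicExtension {3} ℚ K₀]
        [(galRange (K := ℚ) K₀).Normal] (ηq : absoluteGaloisGroup ℚ →* ℤˣ),
        (∀ σ ∈ galRange (K := ℚ) K₀, ηq σ = 1) → ηq ≠ 1 →
      ∀ (V : WeierstrassCurve ℚ) [V.IsElliptic] [V.IsGloballyMinimal] {N : ℕ} [NeZero N]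
        {f : CuspForm (Gamma0 N) 2},
        (3 : ℕ) ≠ 2 → V.HasGoodReductionAtPrime 3 → V.frobeniusTrace 3 = 0 →
        QuadraticBranchPlusMainConjectureAt V 3 → IsNewformOf V f →
      ∀ (ϖ : ℚ), (ϖ : ℝ) * V.imaginaryPeriodRat = minusPeriod f →
      ∀ (Lη : IwasawaAlgebra 3), IsQuadraticBranchMinusLFunction f 3 ϖ Lη →
      ∀ (κ : ZpExtension ℚ 3) (γ : absoluteGaloisGroup ℚ),
        κ.IsCyclotomic → κ.IsTopGenerator γ → γ ∈ galRange (K := ℚ) K₀ →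
        IsCyclotomicVariable 3 γ →
      ∀ (D : EtaSignedSelmerDualData V κ K₀ ℚ_[3] ηq γ (-1)) (L' : IwasawaAlgebra 3),
        Lη = PowerSeries.X * L' → D.charIdeal = Ideal.span {L'}) :
    ∀ (W : WeierstrassCurve ℚ) [W.IsElliptic] [W.IsGloballyMinimal],
      HasSignedLocalType W 3 (.Istar 0) → W.analyticRank = 1 →
      OddBranchStrictMinusNoFiniteSubmoduleAt W 3 ∧
      ∀ (V : WeierstrassCurve ℚ) [V.IsElliptic] [V.IsGloballyMinimal] (C : VariableChange ℚ)
        {N : ℕ} [NeZero N] {f : CuspForm (Gamma0 N) 2},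
        (3 : ℕ) ≠ 2 → C • W.quadraticTwist (-3) = V →
        V.HasGoodReductionAtPrime 3 → V.frobeniusTrace 3 = 0 →
        QuadraticBranchPlusMainConjectureAt V 3 → IsNewformOf V f →
        ∀ (ϖ : ℚ), (ϖ : ℝ) * V.imaginaryPeriodRat = minusPeriod f →
        ∀ (Lη : IwasawaAlgebra 3), IsQuadraticBranchMinusLFunction f 3 ϖ Lη →
        ∀ (κ : ZpExtension ℚ 3) (γ : Field.absoluteGaloisGroup ℚ),
          κ.IsCyclotomic → κ.IsTopGenerator γ → IsCyclotomicVariable 3 γ →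
        ∀ (D : StrictSignedSelmerDualData W κ ℚ_[3] γ (-1)) (L' : IwasawaAlgebra 3),
          Lη = PowerSeries.X * L' → D.charIdeal = Ideal.span {L'} := by
  have h32 : ((-1 : ℚ) ^ (3 / 2) * (3 : ℕ)) = -3 := by norm_num
  have hodd : ¬ Even (3 / 2) := by decide
  intro W _ _ _hT _hr
  refine ⟨SignedTwist.oddBranchStrictMinusNoFiniteSubmoduleAt_of_kitajimaOtsuki13MinusEta W 3 hKO₃,
    ?_⟩
  -- the exact reading: move the period clause to the `if`-form of the dictionary theorem and back
  have h74X' := LevelBridge.exactOddBranchReading_of_kobayashi74OddEtaExact W 3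
    (fun K₀ _ _ _ _ ηq hηK hη1 V _ _ N _ f hp2 hgood hap h1 hf ϖ hϖ Lη hL κ γ hκ hγ hγK hγc D L'
        hLL' ↦ by
      rw [if_neg hodd] at hϖ
      exact h74X₃ K₀ ηq hηK hη1 V hp2 hgood hap h1 hf ϖ hϖ Lη hL κ γ hκ hγ hγK hγc D L' hLL')
  intro V _ _ C N _ f hp2 hC hgood hap h1 hf ϖ hϖ Lη hL κ γ hκ hγ hγc D L' hLL'
  rw [← h32] at hC
  exact h74X' V C hp2 hC hgood hap h1 hf ϖ (by rw [if_neg hodd]; exact hϖ) Lη hL κ γ hκ hγ hγc D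
    L' hLL'

/-- **The readings at `3` from the `p`-GENERIC reading texts of the route's readings item** — the
binders `hKO` / `h74X` of `inertBadSignedBranches_printReadingsInert_of_plusMC_of_verbatimReadings`
(p410220) with their guard `5 ≤ p →` DELETED (the texts already carry `p ≠ 2`; Kobayashi 2003 and
Kitajima–Otsuki 2018 are stated for odd `p` with `a_p = 0`): ONE pair of texts serves the `p ≥ 5` item
`PrintReadingsInert` (restriction) and the `p = 3` child (instantiation at `p = 3`, period clause read
through `¬ Even (3 / 2)`). CONDITIONAL; nothing about the printed theorems is asserted.
[cite: KitajimaOtsuki2018, Main Thm. 1.3 (= Thm. 4.8) with Def. 2.1 (arXiv:1607.03612 pp. 3, 6)]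
[cite: Kobayashi2003, Thm. 7.4 (p. 13), §4 (p. 8)] -/
theorem inertBadSignedBranches_readingsAtThree_of_oddVerbatimReadings
    (hKO : ∀ (p : ℕ) [Fact p.Prime],
      ∀ (K₀ : Type) [Field K₀] [NumberField K₀] [IsCyclotomicExtension {p} ℚ K₀]
        [(galRange (K := ℚ) K₀).Normal] (ηq : absoluteGaloisGroup ℚ →* ℤˣ),
        (∀ σ ∈ galRange (K := ℚ) K₀, ηq σ = 1) →
      ∀ (V : WeierstrassCurve ℚ) [V.IsElliptic] [V.IsGloballyMinimal],
        p ≠ 2 → V.HasGoodReductionAtPrime p → V.frobeniusTrace p = 0 →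
      ∀ (κ : ZpExtension ℚ p) (γ : absoluteGaloisGroup ℚ),
        κ.IsCyclotomic → κ.IsTopGenerator γ → γ ∈ galRange (K := ℚ) K₀ →
      ∀ (D : EtaSignedSelmerDualData V κ K₀ ℚ_[p] ηq γ (-1)),
        Module.Finite (IwasawaAlgebra p) D.X → Module.IsTorsion (IwasawaAlgebra p) D.X →
        ∀ M : Submodule (IwasawaAlgebra p) D.X, Finite M → M = ⊥)
    (h74X : ∀ (p : ℕ) [Fact p.Prime],
      ∀ (K₀ : Type) [Field K₀] [NumberField K₀] [IsCyclotomicExtension {p} ℚ K₀]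
        [(galRange (K := ℚ) K₀).Normal] (ηq : absoluteGaloisGroup ℚ →* ℤˣ),
        (∀ σ ∈ galRange (K := ℚ) K₀, ηq σ = 1) → ηq ≠ 1 →
      ∀ (V : WeierstrassCurve ℚ) [V.IsElliptic] [V.IsGloballyMinimal] {N : ℕ} [NeZero N]
        {f : CuspForm (Gamma0 N) 2},
        p ≠ 2 → V.HasGoodReductionAtPrime p → V.frobeniusTrace p = 0 →
        QuadraticBranchPlusMainConjectureAt V p → IsNewformOf V f →
      ∀ (ϖ : ℚ), (if Even (p / 2) then (ϖ : ℝ) * V.realPeriodRat = plusPeriod f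
          else (ϖ : ℝ) * V.imaginaryPeriodRat = minusPeriod f) →
      ∀ (Lη : IwasawaAlgebra p), IsQuadraticBranchMinusLFunction f p ϖ Lη →
      ∀ (κ : ZpExtension ℚ p) (γ : absoluteGaloisGroup ℚ),
        κ.IsCyclotomic → κ.IsTopGenerator γ → γ ∈ galRange (K := ℚ) K₀ →
        IsCyclotomicVariable p γ →
      ∀ (D : EtaSignedSelmerDualData V κ K₀ ℚ_[p] ηq γ (-1)) (L' : IwasawaAlgebra p),
        Lη = PowerSeries.X * L' → D.charIdeal = Ideal.span {L'}) :
    ∀ (W : WeierstrassCurve ℚ) [W.IsElliptic] [W.IsGloballyMinimal],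
      HasSignedLocalType W 3 (.Istar 0) → W.analyticRank = 1 →
      OddBranchStrictMinusNoFiniteSubmoduleAt W 3 ∧
      ∀ (V : WeierstrassCurve ℚ) [V.IsElliptic] [V.IsGloballyMinimal] (C : VariableChange ℚ)
        {N : ℕ} [NeZero N] {f : CuspForm (Gamma0 N) 2},
        (3 : ℕ) ≠ 2 → C • W.quadraticTwist (-3) = V →
        V.HasGoodReductionAtPrime 3 → V.frobeniusTrace 3 = 0 →
        QuadraticBranchPlusMainConjectureAt V 3 → IsNewformOf V f →
        ∀ (ϖ : ℚ), (ϖ : ℝ) * V.imaginaryPeriodRat = minusPeriod f →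
        ∀ (Lη : IwasawaAlgebra 3), IsQuadraticBranchMinusLFunction f 3 ϖ Lη →
        ∀ (κ : ZpExtension ℚ 3) (γ : Field.absoluteGaloisGroup ℚ),
          κ.IsCyclotomic → κ.IsTopGenerator γ → IsCyclotomicVariable 3 γ →
        ∀ (D : StrictSignedSelmerDualData W κ ℚ_[3] γ (-1)) (L' : IwasawaAlgebra 3),
          Lη = PowerSeries.X * L' → D.charIdeal = Ideal.span {L'} := by
  have hodd : ¬ Even (3 / 2) := by decide
  refine inertBadSignedBranches_readingsAtThree_of_verbatimReadingsAtThree (hKO 3) ?_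
  intro K₀ _ _ _ _ ηq hηK hη1 V _ _ N _ f hp2 hgood hap h1 hf ϖ hϖ Lη hL κ γ hκ hγ hγK hγc D L' hLL'
  exact h74X 3 K₀ ηq hηK hη1 V hp2 hgood hap h1 hf ϖ (by rw [if_neg hodd]; exact hϖ) Lη hL κ γ hκ hγ
    hγK hγc D L' hLL'

/-- **THE D71 CHILD `InertBadAtThreeIstarZero` MODULO (GZ_η-VAL)@3 ∧ (C1_η)@3 ∧ `hKO₃` ∧ `h74X₃` ∧ the
route's support item `PublishedFactsInert`** — one displayed binder per `p = 3` input, the law in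
print/LOG currency: `hGZη₃` = the η-branch `3`-adic Gross–Zagier VALUATION identity on the type
(`coeff₁ L ≠ 0 ∧ v₃(coeff₁ L) = 2·ord₃ log_ω(P) + ord₃ q`, `q = L′(W,1)/(Ω_W·Reg W)`; the cell's own
statement, PAPER from (GZ_η)@3 by memo N21 v1.2 — NO print; a HYPOTHESIS), `hC1₃` = (C1_η)@3 for the CM
good-inert curves at `3` (Pollack–Rubin's remark, `p > 2`), `hKO₃` / `h74X₃` = the two VERBATIM reading
texts at `p = 3` (Kitajima–Otsuki 2018 Main Thm. 1.3 sign `−`; Kobayashi 2003 Thm. 7.4 (ii) exact),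
`h₆` = `PublishedFactsInert` verbatim (entire `L`, Gross–Zagier I.7.3, GZK, Poitou–Tate, modularity,
Mazur's `p ∤ c₀`; `ord₃ c₃(W) = 0` and the period datum at `3` are discharged inside, by
`InertBadOdd.padicValNat_localTamagawaNumber_eq_zero_of_hasCM_three` and
`InertBadOdd.periodRatio_three_of_mazur`). Composition:
`inertBadSignedBranches_readingsAtThree_of_verbatimReadingsAtThree` into x1b's
`inertBadSignedBranches_inertBadAtThreeIstarZero_of_etaGZValuationAtThree_of_readingsAtThree`.
CONDITIONAL on every displayed hypothesis; the item stays OPEN; nothing booked.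
[cite: Kobayashi2003, §4 (p. 8), Thm. 7.4 (p. 13)] [cite: KitajimaOtsuki2018, Main Thm. 1.3 (arXiv:1607.03612 p. 3)]
[cite: PollackRubin2004, p. 448 (remark)] [cite: Mazur1978, Cor. 4.1]
[cite: SilvermanAEC2009, IV.6.4 and VII.6.3] [cite: SilvermanATAEC1994, IV.9.4 and Table 4.1]
[cite: Miller2011LMS, §1 and Def. 1.1] -/
theorem inertBadSignedBranches_inertBadAtThreeIstarZero_of_etaGZValuationAtThree_of_verbatimReadingsAtThree
    (hGZη₃ : ∀ (W : WeierstrassCurve ℚ) [W.IsElliptic] [W.IsGloballyMinimal],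
      HasSignedLocalType W 3 (.Istar 0) → W.analyticRank = 1 →
      ∀ (V : WeierstrassCurve ℚ) [V.IsElliptic] [V.IsGloballyMinimal] (C : VariableChange ℚ)
        {N : ℕ} [NeZero N] {f : CuspForm (Gamma0 N) 2},
        C • W.quadraticTwist (-3) = V →
        V.HasGoodReductionAtPrime 3 → V.frobeniusTrace 3 = 0 → IsNewformOf V f →
        ∀ (ϖ : ℚ), (ϖ : ℝ) * V.imaginaryPeriodRat = minusPeriod f →
        ∀ (L : IwasawaAlgebra 3), IsQuadraticBranchMinusLFunction f 3 ϖ L →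
        ∀ (P : W.toAffine.Point), ¬ IsOfFinAddOrder P →
        (∀ R : W.toAffine.Point, ∃ (k : ℤ) (T : W.toAffine.Point), IsOfFinAddOrder T ∧ R = k • P + T) →
        ∀ (q : ℚ), W.leadingLCoeff / ((W.realPeriodRat * W.regulator : ℝ) : ℂ) = (q : ℂ) →
        PowerSeries.coeff 1 L ≠ 0 ∧
          ((PowerSeries.coeff 1 L : ℤ_[3]) : ℚ_[3]).valuation =
            2 * (padicLog (W.baseChange ℚ_[3]) (W.toPadicPoint 3 P)).valuation + padicValRat 3 q)
    (hC1₃ : ∀ (V : WeierstrassCurve ℚ) [V.IsElliptic] [V.IsGloballyMinimal],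
      V.HasCM → V.HasGoodReductionAtPrime 3 → CMInert V 3 → QuadraticBranchPlusMainConjectureAt V 3)
    (hKO₃ : ∀ (K₀ : Type) [Field K₀] [NumberField K₀] [IsCyclotomicExtension {3} ℚ K₀]
        [(galRange (K := ℚ) K₀).Normal] (ηq : absoluteGaloisGroup ℚ →* ℤˣ),
        (∀ σ ∈ galRange (K := ℚ) K₀, ηq σ = 1) →
      ∀ (V : WeierstrassCurve ℚ) [V.IsElliptic] [V.IsGloballyMinimal],
        (3 : ℕ) ≠ 2 → V.HasGoodReductionAtPrime 3 → V.frobeniusTrace 3 = 0 →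
      ∀ (κ : ZpExtension ℚ 3) (γ : absoluteGaloisGroup ℚ),
        κ.IsCyclotomic → κ.IsTopGenerator γ → γ ∈ galRange (K := ℚ) K₀ →
      ∀ (D : EtaSignedSelmerDualData V κ K₀ ℚ_[3] ηq γ (-1)),
        Module.Finite (IwasawaAlgebra 3) D.X → Module.IsTorsion (IwasawaAlgebra 3) D.X →
        ∀ M : Submodule (IwasawaAlgebra 3) D.X, Finite M → M = ⊥)
    (h74X₃ : ∀ (K₀ : Type) [Field K₀] [NumberField K₀] [IsCyclotomicExtension {3} ℚ K₀]
        [(galRange (K := ℚ) K₀).Normal] (ηq : absoluteGaloisGroup ℚ →* ℤˣ),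
        (∀ σ ∈ galRange (K := ℚ) K₀, ηq σ = 1) → ηq ≠ 1 →
      ∀ (V : WeierstrassCurve ℚ) [V.IsElliptic] [V.IsGloballyMinimal] {N : ℕ} [NeZero N]
        {f : CuspForm (Gamma0 N) 2},
        (3 : ℕ) ≠ 2 → V.HasGoodReductionAtPrime 3 → V.frobeniusTrace 3 = 0 →
        QuadraticBranchPlusMainConjectureAt V 3 → IsNewformOf V f →
      ∀ (ϖ : ℚ), (ϖ : ℝ) * V.imaginaryPeriodRat = minusPeriod f →
      ∀ (Lη : IwasawaAlgebra 3), IsQuadraticBranchMinusLFunction f 3 ϖ Lη →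
      ∀ (κ : ZpExtension ℚ 3) (γ : absoluteGaloisGroup ℚ),
        κ.IsCyclotomic → κ.IsTopGenerator γ → γ ∈ galRange (K := ℚ) K₀ →
        IsCyclotomicVariable 3 γ →
      ∀ (D : EtaSignedSelmerDualData V κ K₀ ℚ_[3] ηq γ (-1)) (L' : IwasawaAlgebra 3),
        Lη = PowerSeries.X * L' → D.charIdeal = Ideal.span {L'})
    (h₆ : PublishedFactsInert) :
    Summit.BirchSwinnertonDyer.BirchSwinnertonDyer.Theses.InertBadSignedBranches.InertBadAtThreeIstarZero := by
  unfold Summit.BirchSwinnertonDyer.BirchSwinnertonDyer.Theses.InertBadSignedBranches.InertBadAtThreeIstarZero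
  intro W _ _ _ hT hr
  exact inertBadSignedBranches_inertBadAtThreeIstarZero_of_etaGZValuationAtThree_of_readingsAtThree
    hGZη₃ ⟨hC1₃, inertBadSignedBranches_readingsAtThree_of_verbatimReadingsAtThree hKO₃ h74X₃⟩
    h₆ W hT hr

/-- **THE D71 CHILD `InertBadAtThreeIstarZero` MODULO C-cc-1@3 (pair/LEVEL form) ∧ (C1_η)@3 ∧ `hKO₃` ∧
`h74X₃` ∧ `PublishedFactsInert`** — the same with the law displayed in the pair/LEVEL normal form of
record (`hlaw₃`: at `3`-divisibility level `n` of the generator `P` in `W(ℚ₃)`, under `W(ℚ₃)[3] = 0`,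
`coeff₁ L ≠ 0 ∧ v₃(coeff₁ L) = 2n + ord₃(#Ш_an(W)·∏c_v/#tors²)`; the `p = 3` reading of the route crux
`CccOneLawOnTypeIstarZero`'s unfolded body with `ord₃ c₃(W) = 0` inlined, i.e. the `+ δ`-free normal
form: a guard-free typed C-cc-1 item with `+ δ` instantiates it by `add_zero`, NIT-K8P3-2). Composition:
`inertBadSignedBranches_readingsAtThree_of_verbatimReadingsAtThree` into x1b's
`inertBadSignedBranches_inertBadAtThreeIstarZero_of_pairLawAtThree_of_readingsAtThree`. CONDITIONAL on
every displayed hypothesis; the item stays OPEN; nothing booked.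
[cite: Kobayashi2003, §4 (p. 8), Thm. 7.4 (p. 13)] [cite: KitajimaOtsuki2018, Main Thm. 1.3 (arXiv:1607.03612 p. 3)]
[cite: PollackRubin2004, p. 448 (remark)] [cite: Mazur1978, Cor. 4.1]
[cite: SilvermanATAEC1994, IV.9.4 and Table 4.1] [cite: Miller2011LMS, §1 and Def. 1.1] -/
theorem inertBadSignedBranches_inertBadAtThreeIstarZero_of_pairLawAtThree_of_verbatimReadingsAtThree
    (hlaw₃ : ∀ (W : WeierstrassCurve ℚ) [W.IsElliptic] [W.IsGloballyMinimal],
      HasSignedLocalType W 3 (.Istar 0) → W.analyticRank = 1 →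
      ∀ (V : WeierstrassCurve ℚ) [V.IsElliptic] [V.IsGloballyMinimal] (C : VariableChange ℚ)
        {N : ℕ} [NeZero N] {f : CuspForm (Gamma0 N) 2},
        C • W.quadraticTwist (-3) = V →
        V.HasGoodReductionAtPrime 3 → V.frobeniusTrace 3 = 0 → IsNewformOf V f →
        ∀ (ϖ : ℚ), (ϖ : ℝ) * V.imaginaryPeriodRat = minusPeriod f →
        ∀ (L : IwasawaAlgebra 3), IsQuadraticBranchMinusLFunction f 3 ϖ L →
        (∀ Q : (W.baseChange ℚ_[3]).toAffine.Point, 3 • Q = 0 → Q = 0) →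
        ∀ (P : W.toAffine.Point) (n : ℕ), ¬ IsOfFinAddOrder P →
        (∀ R : W.toAffine.Point, ∃ (k : ℤ) (T : W.toAffine.Point), IsOfFinAddOrder T ∧ R = k • P + T) →
        (∃ Q : (W.baseChange ℚ_[3]).toAffine.Point, 3 ^ n • Q = W.toPadicPoint 3 P) →
        (∀ Q : (W.baseChange ℚ_[3]).toAffine.Point, 3 ^ (n + 1) • Q ≠ W.toPadicPoint 3 P) →
        ∀ (q : ℚ), shaAn W = (q : ℂ) →
        PowerSeries.coeff 1 L ≠ 0 ∧
          ((PowerSeries.coeff 1 L : ℤ_[3]) : ℚ_[3]).valuation =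
            2 * (n : ℤ) + padicValRat 3 (q * W.tamagawaProduct / (W.torsionOrder : ℚ) ^ 2))
    (hC1₃ : ∀ (V : WeierstrassCurve ℚ) [V.IsElliptic] [V.IsGloballyMinimal],
      V.HasCM → V.HasGoodReductionAtPrime 3 → CMInert V 3 → QuadraticBranchPlusMainConjectureAt V 3)
    (hKO₃ : ∀ (K₀ : Type) [Field K₀] [NumberField K₀] [IsCyclotomicExtension {3} ℚ K₀]
        [(galRange (K := ℚ) K₀).Normal] (ηq : absoluteGaloisGroup ℚ →* ℤˣ),
        (∀ σ ∈ galRange (K := ℚ) K₀, ηq σ = 1) →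
      ∀ (V : WeierstrassCurve ℚ) [V.IsElliptic] [V.IsGloballyMinimal],
        (3 : ℕ) ≠ 2 → V.HasGoodReductionAtPrime 3 → V.frobeniusTrace 3 = 0 →
      ∀ (κ : ZpExtension ℚ 3) (γ : absoluteGaloisGroup ℚ),
        κ.IsCyclotomic → κ.IsTopGenerator γ → γ ∈ galRange (K := ℚ) K₀ →
      ∀ (D : EtaSignedSelmerDualData V κ K₀ ℚ_[3] ηq γ (-1)),
        Module.Finite (IwasawaAlgebra 3) D.X → Module.IsTorsion (IwasawaAlgebra 3) D.X →
        ∀ M : Submodule (IwasawaAlgebra 3) D.X, Finite M → M = ⊥)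
    (h74X₃ : ∀ (K₀ : Type) [Field K₀] [NumberField K₀] [IsCyclotomicExtension {3} ℚ K₀]
        [(galRange (K := ℚ) K₀).Normal] (ηq : absoluteGaloisGroup ℚ →* ℤˣ),
        (∀ σ ∈ galRange (K := ℚ) K₀, ηq σ = 1) → ηq ≠ 1 →
      ∀ (V : WeierstrassCurve ℚ) [V.IsElliptic] [V.IsGloballyMinimal] {N : ℕ} [NeZero N]
        {f : CuspForm (Gamma0 N) 2},
        (3 : ℕ) ≠ 2 → V.HasGoodReductionAtPrime 3 → V.frobeniusTrace 3 = 0 →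
        QuadraticBranchPlusMainConjectureAt V 3 → IsNewformOf V f →
      ∀ (ϖ : ℚ), (ϖ : ℝ) * V.imaginaryPeriodRat = minusPeriod f →
      ∀ (Lη : IwasawaAlgebra 3), IsQuadraticBranchMinusLFunction f 3 ϖ Lη →
      ∀ (κ : ZpExtension ℚ 3) (γ : absoluteGaloisGroup ℚ),
        κ.IsCyclotomic → κ.IsTopGenerator γ → γ ∈ galRange (K := ℚ) K₀ →
        IsCyclotomicVariable 3 γ →
      ∀ (D : EtaSignedSelmerDualData V κ K₀ ℚ_[3] ηq γ (-1)) (L' : IwasawaAlgebra 3),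
        Lη = PowerSeries.X * L' → D.charIdeal = Ideal.span {L'})
    (h₆ : PublishedFactsInert) :
    Summit.BirchSwinnertonDyer.BirchSwinnertonDyer.Theses.InertBadSignedBranches.InertBadAtThreeIstarZero := by
  unfold Summit.BirchSwinnertonDyer.BirchSwinnertonDyer.Theses.InertBadSignedBranches.InertBadAtThreeIstarZero
  intro W _ _ _ hT hr
  exact inertBadSignedBranches_inertBadAtThreeIstarZero_of_pairLawAtThree_of_readingsAtThree
    hlaw₃ ⟨hC1₃, inertBadSignedBranches_readingsAtThree_of_verbatimReadingsAtThree hKO₃ h74X₃⟩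
    h₆ W hT hr

end Summit.BirchSwinnertonDyer.BirchSwinnertonDyer.Theorems

end
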